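import Summits.Ventures.PercRepro.C041TriDomAnchoredCone

/-!
# ROW C-041 — THE ANCHORED CONE FOR FOUR MARKS: every four-mark pattern functional anchored at a mark is a theorem
on every up-set of every status (p6, gen 48; P6-TWOEXIT-LEAN.md §53 ADDENDUM 22 cont. 8)

The four-mark version of THEOREM (THE ANCHORED CONE): marks `x = a₁` (the anchor), `y = u`, `z = u'`, `w = u''`,
patterns `P6 = (xy, xz, xw, yz, yw, zw)` (`rsig6` / `bsig6` of `C041TriDomExcessFour`).  An X-MERGE of four-mark
patterns (`XMerge6`) is a refinement `s ≤ s'` in which two non-anchor marks are joined only if the anchor joins them: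
exactly the merges produced by adding an edge at the anchor's double-component (`xmerge6_rsig6`, `xmerge6_bsig6`).
For a functional `F : P6 → P6 → ℤ` that (a) vanishes when the anchor's three connections agree (`Anchored6`),
(i) is increasing in red along x-merges (`IncrRed6`) and (ii) satisfies the key inequality on x-merges (`KeyIneq6`)
— decidable conditions, `decide`s over the fifteen partitions `valid6` — the count `cntF6 F st V = Σ_{ω ∈ V} F (rsig6
st ω) (bsig6 st ω)` is non-negative on every up-set of every status (`cntF6_nonneg_of_anchored`): the proof of
THEOREM (S1) with the patterns widened to four marks.  This is the tool the one-far-mark 2-cut transport of ADDENDUM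
21 needs on the near host with marks `x, y, u, v`.
-/

namespace PercRepro

namespace ZoneZ

namespace MultiExit

open ZoneData Finset

variable {V₁ E₁ U₁ U₂ : Type} (Z₁ : ZoneData V₁ E₁ U₁ U₂) (u u' u'' a₁ : V₁)

/-! ## X-merges of four-mark patterns and the three conditions -/

/-- An x-merge of four-mark patterns: `s ≤ s'`, and two non-anchor marks joined in `s'` were joined in `s` or are
joined to the anchor in `s'`. -/
def XMerge6 (s s' : P6) : Prop :=
  Le6 s s' ∧ (s'.2.2.2.1 = true → s.2.2.2.1 = true ∨ s'.1 = true) ∧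
    (s'.2.2.2.2.1 = true → s.2.2.2.2.1 = true ∨ s'.1 = true) ∧
    (s'.2.2.2.2.2 = true → s.2.2.2.2.2 = true ∨ s'.2.1 = true)

/-- X-merging is decidable. -/
instance (s s' : P6) : Decidable (XMerge6 s s') := by unfold XMerge6; infer_instance

/-- (a) The functional vanishes when the anchor's three connections agree in the two colours. -/
def Anchored6 (F : P6 → P6 → ℤ) : Prop :=
  ∀ s t : P6, s.1 = t.1 → s.2.1 = t.2.1 → s.2.2.1 = t.2.2.1 → F s t = 0

/-- (i) The functional is increasing in the red pattern along x-merges (on the partitions). -/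
def IncrRed6 (F : P6 → P6 → ℤ) : Prop :=
  ∀ s ∈ valid6, ∀ s' ∈ valid6, ∀ t ∈ valid6, XMerge6 s s' → F s t ≤ F s' t

/-- (ii) The key inequality along x-merges in both colours (on the partitions). -/
def KeyIneq6 (F : P6 → P6 → ℤ) : Prop :=
  ∀ s ∈ valid6, ∀ s' ∈ valid6, ∀ t ∈ valid6, ∀ t' ∈ valid6, XMerge6 s s' → XMerge6 t t' →
    F s t + F s' t' ≤ F s' t + F s t'

/-- Condition (a) is decidable. -/
instance (F : P6 → P6 → ℤ) : Decidable (Anchored6 F) := by unfold Anchored6; infer_instance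

/-- Condition (i) is decidable. -/
instance (F : P6 → P6 → ℤ) : Decidable (IncrRed6 F) := by unfold IncrRed6; infer_instance

/-- Condition (ii) is decidable. -/
instance (F : P6 → P6 → ℤ) : Decidable (KeyIneq6 F) := by unfold KeyIneq6; infer_instance

/-- The pointwise inequality of the induction step for an anchored four-mark functional. -/
theorem F6_ind_ineq {F : P6 → P6 → ℤ} (hi : IncrRed6 F) (hii : KeyIneq6 F) (a b : Prop) [Decidable a]
    [Decidable b] (hba : b → a) (s s' t t' : P6) (hs : Trans6 s) (hs' : Trans6 s') (ht : Trans6 t)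
    (ht' : Trans6 t') (hx : XMerge6 s s') (hy : XMerge6 t t') :
    ((if a then F s t else 0) + (if b then F s' t' else 0) : ℤ) ≤
      (if a then F s' t else 0) + (if b then F s t' else 0) := by
  have k1 := hi s (trans6_mem s hs) s' (trans6_mem s' hs') t (trans6_mem t ht) hx
  have k2 := hii s (trans6_mem s hs) s' (trans6_mem s' hs') t (trans6_mem t ht) t' (trans6_mem t' ht') hx hy
  by_cases ha : a <;> by_cases hb : b
  · simp only [ha, hb, ↓reduceIte]; exact k2
  · simp only [ha, hb, ↓reduceIte, add_zero]; exact k1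
  · exact absurd (hba hb) ha
  · simp only [ha, hb, ↓reduceIte, add_zero, le_refl]

/-! ## The merges at an edge touching the anchor's double-component -/

variable [DecidableEq E₁]

/-- Two vertices red-connected under the contraction but not under the deletion are both red-connected to the
anchor under the contraction (the edge touches the anchor's double-component). -/
theorem RdS_anchor_of_double_not_absent {st : E₁ → EStat} {f : E₁} (hf : st f = .free)
    (hT : Z₁.fst f ∈ dblCompS Z₁ st a₁ ∨ Z₁.snd f ∈ dblCompS Z₁ st a₁) (ω : E₁ → Bool) {a b : V₁}
    (hd : RdS Z₁ (Function.update st f .double) ω a b) (hn : ¬ RdS Z₁ (Function.update st f .absent) ω a b) :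
    RdS Z₁ (Function.update st f .double) ω a₁ a := by
  obtain ⟨he1, he2⟩ := ends_RdS_double Z₁ a₁ hf hT ω
  rcases RdS_double_cases Z₁ st f ω a b hd with h | h | h
  · exact absurd h hn
  · exact reach_trans' he1 (RdS_symm_S1 Z₁ _ ω (RdS_absent_le_double_S1 Z₁ st f ω h))
  · exact reach_trans' he2 (RdS_symm_S1 Z₁ _ ω (RdS_absent_le_double_S1 Z₁ st f ω h))

/-- Two vertices blue-connected under the contraction but not under the deletion are both blue-connected to the
anchor under the contraction. -/
theorem MgS_anchor_of_double_not_absent {st : E₁ → EStat} {f : E₁} (hf : st f = .free)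
    (hT : Z₁.fst f ∈ dblCompS Z₁ st a₁ ∨ Z₁.snd f ∈ dblCompS Z₁ st a₁) (ω : E₁ → Bool) {a b : V₁}
    (hd : MgS Z₁ (Function.update st f .double) ω a b) (hn : ¬ MgS Z₁ (Function.update st f .absent) ω a b) :
    MgS Z₁ (Function.update st f .double) ω a₁ a := by
  obtain ⟨he1, he2⟩ := ends_MgS_double Z₁ a₁ hf hT ω
  rcases MgS_double_cases Z₁ st f ω a b hd with h | h | h
  · exact absurd h hn
  · exact reach_trans' he1 (MgS_symm_S1 Z₁ _ ω (MgS_absent_le_double_S1 Z₁ st f ω h))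
  · exact reach_trans' he2 (MgS_symm_S1 Z₁ _ ω (MgS_absent_le_double_S1 Z₁ st f ω h))

/-- The red four-mark merge at an edge touching the anchor's double-component is an x-merge. -/
theorem xmerge6_rsig6 {st : E₁ → EStat} {f : E₁} (hf : st f = .free)
    (hT : Z₁.fst f ∈ dblCompS Z₁ st a₁ ∨ Z₁.snd f ∈ dblCompS Z₁ st a₁) (ω : E₁ → Bool) :
    XMerge6 (rsig6 Z₁ u u' u'' a₁ (Function.update st f .absent) ω)
      (rsig6 Z₁ u u' u'' a₁ (Function.update st f .double) ω) := by
  refine ⟨le6_rsig6 Z₁ u u' u'' a₁ st f ω, ?_, ?_, ?_⟩ <;> simp only [rsig6, decide_eq_true_eq] <;> intro hd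
  · by_cases hn : RdS Z₁ (Function.update st f .absent) ω u u'
    · exact Or.inl hn
    · exact Or.inr (RdS_anchor_of_double_not_absent Z₁ a₁ hf hT ω hd hn)
  · by_cases hn : RdS Z₁ (Function.update st f .absent) ω u u''
    · exact Or.inl hn
    · exact Or.inr (RdS_anchor_of_double_not_absent Z₁ a₁ hf hT ω hd hn)
  · by_cases hn : RdS Z₁ (Function.update st f .absent) ω u' u''
    · exact Or.inl hn
    · exact Or.inr (RdS_anchor_of_double_not_absent Z₁ a₁ hf hT ω hd hn)

/-- The blue four-mark merge at an edge touching the anchor's double-component is an x-merge. -/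
theorem xmerge6_bsig6 {st : E₁ → EStat} {f : E₁} (hf : st f = .free)
    (hT : Z₁.fst f ∈ dblCompS Z₁ st a₁ ∨ Z₁.snd f ∈ dblCompS Z₁ st a₁) (ω : E₁ → Bool) :
    XMerge6 (bsig6 Z₁ u u' u'' a₁ (Function.update st f .absent) ω)
      (bsig6 Z₁ u u' u'' a₁ (Function.update st f .double) ω) := by
  refine ⟨le6_bsig6 Z₁ u u' u'' a₁ st f ω, ?_, ?_, ?_⟩ <;> simp only [bsig6, decide_eq_true_eq] <;> intro hd
  · by_cases hn : MgS Z₁ (Function.update st f .absent) ω u u'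
    · exact Or.inl hn
    · exact Or.inr (MgS_anchor_of_double_not_absent Z₁ a₁ hf hT ω hd hn)
  · by_cases hn : MgS Z₁ (Function.update st f .absent) ω u u''
    · exact Or.inl hn
    · exact Or.inr (MgS_anchor_of_double_not_absent Z₁ a₁ hf hT ω hd hn)
  · by_cases hn : MgS Z₁ (Function.update st f .absent) ω u' u''
    · exact Or.inl hn
    · exact Or.inr (MgS_anchor_of_double_not_absent Z₁ a₁ hf hT ω hd hn)

/-! ## The patterns at a free edge, by its colour -/

/-- A red free edge: the red four-mark pattern is the contraction's. -/
theorem rsig6_of_true {st : E₁ → EStat} {f : E₁} (hf : st f = .free) {ω : E₁ → Bool} (hω : ω f = true) :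
    rsig6 Z₁ u u' u'' a₁ st ω = rsig6 Z₁ u u' u'' a₁ (Function.update st f .double) ω :=
  rsig6_congr Z₁ u u' u'' a₁ (RAdjS_of_true Z₁ hf hω)

/-- A blue free edge: the red four-mark pattern is the deletion's. -/
theorem rsig6_of_false {st : E₁ → EStat} {f : E₁} (hf : st f = .free) {ω : E₁ → Bool} (hω : ω f = false) :
    rsig6 Z₁ u u' u'' a₁ st ω = rsig6 Z₁ u u' u'' a₁ (Function.update st f .absent) ω :=
  rsig6_congr Z₁ u u' u'' a₁ (RAdjS_of_false Z₁ hf hω)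

/-- A red free edge: the blue four-mark pattern is the deletion's. -/
theorem bsig6_of_true {st : E₁ → EStat} {f : E₁} (hf : st f = .free) {ω : E₁ → Bool} (hω : ω f = true) :
    bsig6 Z₁ u u' u'' a₁ st ω = bsig6 Z₁ u u' u'' a₁ (Function.update st f .absent) ω :=
  bsig6_congr Z₁ u u' u'' a₁ (BAdjS_of_true Z₁ hf hω)

/-- A blue free edge: the blue four-mark pattern is the contraction's. -/
theorem bsig6_of_false {st : E₁ → EStat} {f : E₁} (hf : st f = .free) {ω : E₁ → Bool} (hω : ω f = false) :
    bsig6 Z₁ u u' u'' a₁ st ω = bsig6 Z₁ u u' u'' a₁ (Function.update st f .double) ω :=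
  bsig6_congr Z₁ u u' u'' a₁ (BAdjS_of_false Z₁ hf hω)

/-- A non-free edge ignores the flip of its colour (red four-mark pattern). -/
theorem rsig6_flip_nonfree (st : E₁ → EStat) (f : E₁) {s : EStat} (hs : s ≠ .free) (ω : E₁ → Bool) :
    rsig6 Z₁ u u' u'' a₁ (Function.update st f s) (flipC f ω) =
      rsig6 Z₁ u u' u'' a₁ (Function.update st f s) ω :=
  rsig6_congr Z₁ u u' u'' a₁ (RAdjS_update_nonfree Z₁ st f hs ω _)

/-- A non-free edge ignores the flip of its colour (blue four-mark pattern). -/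
theorem bsig6_flip_nonfree (st : E₁ → EStat) (f : E₁) {s : EStat} (hs : s ≠ .free) (ω : E₁ → Bool) :
    bsig6 Z₁ u u' u'' a₁ (Function.update st f s) (flipC f ω) =
      bsig6 Z₁ u u' u'' a₁ (Function.update st f s) ω :=
  bsig6_congr Z₁ u u' u'' a₁ (BAdjS_update_nonfree Z₁ st f hs ω _)

/-! ## The count and its recursion -/

variable [Fintype E₁]

open Classical in
/-- The count of a four-mark pattern functional over a family of colourings of a status. -/
noncomputable def cntF6 (F : P6 → P6 → ℤ) (st : E₁ → EStat) (V : (E₁ → Bool) → Prop) : ℤ :=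
  ∑ ω : E₁ → Bool, if V ω then F (rsig6 Z₁ u u' u'' a₁ st ω) (bsig6 Z₁ u u' u'' a₁ st ω) else 0

omit [Fintype E₁] in
open Classical in
/-- The summand at `ω` and at the flip of a free edge `f`. -/
theorem F6_summand_add_flip (F : P6 → P6 → ℤ) (st : E₁ → EStat) (f : E₁) (hf : st f = .free)
    (V : (E₁ → Bool) → Prop) (ω : E₁ → Bool) :
    ((if V ω then F (rsig6 Z₁ u u' u'' a₁ st ω) (bsig6 Z₁ u u' u'' a₁ st ω) else 0)
      + (if V (flipC f ω) then
          F (rsig6 Z₁ u u' u'' a₁ st (flipC f ω)) (bsig6 Z₁ u u' u'' a₁ st (flipC f ω)) else 0) : ℤ) =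
      (if sliceV V f true ω then
          F (rsig6 Z₁ u u' u'' a₁ (Function.update st f .double) ω)
            (bsig6 Z₁ u u' u'' a₁ (Function.update st f .absent) ω)
        else 0)
        + (if sliceV V f false ω then
            F (rsig6 Z₁ u u' u'' a₁ (Function.update st f .absent) ω)
              (bsig6 Z₁ u u' u'' a₁ (Function.update st f .double) ω)
          else 0) := by
  have hd : EStat.double ≠ EStat.free := by decide
  have ha : EStat.absent ≠ EStat.free := by decide
  have h3 : V ω ↔ sliceV V f (ω f) ω := (sliceV_self V f ω).symm
  have h4 : V (flipC f ω) ↔ sliceV V f (!ω f) ω := Iff.rfl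
  cases hω : ω f
  · have hω' : flipC f ω f = true := by simp [flipC_apply_self, hω]
    rw [rsig6_of_false Z₁ u u' u'' a₁ hf hω, bsig6_of_false Z₁ u u' u'' a₁ hf hω,
      rsig6_of_true Z₁ u u' u'' a₁ hf hω', bsig6_of_true Z₁ u u' u'' a₁ hf hω',
      rsig6_flip_nonfree Z₁ u u' u'' a₁ st f hd, bsig6_flip_nonfree Z₁ u u' u'' a₁ st f ha]
    rw [hω] at h3 h4
    simp only [Bool.not_false] at h4
    rw [if_congr h3 rfl rfl, if_congr h4 rfl rfl]
    ring
  · have hω' : flipC f ω f = false := by simp [flipC_apply_self, hω]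
    rw [rsig6_of_true Z₁ u u' u'' a₁ hf hω, bsig6_of_true Z₁ u u' u'' a₁ hf hω,
      rsig6_of_false Z₁ u u' u'' a₁ hf hω', bsig6_of_false Z₁ u u' u'' a₁ hf hω',
      rsig6_flip_nonfree Z₁ u u' u'' a₁ st f ha, bsig6_flip_nonfree Z₁ u u' u'' a₁ st f hd]
    rw [hω] at h3 h4
    simp only [Bool.not_true] at h4
    rw [if_congr h3 rfl rfl, if_congr h4 rfl rfl]

open Classical in
/-- The recursion of the four-mark count at a free edge. -/
theorem cntF6_rec (F : P6 → P6 → ℤ) (st : E₁ → EStat) (f : E₁) (hf : st f = .free)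
    (V : (E₁ → Bool) → Prop) :
    2 * cntF6 Z₁ u u' u'' a₁ F st V =
      (∑ ω : E₁ → Bool, if sliceV V f true ω then
          F (rsig6 Z₁ u u' u'' a₁ (Function.update st f .double) ω)
            (bsig6 Z₁ u u' u'' a₁ (Function.update st f .absent) ω)
        else 0)
        + ∑ ω : E₁ → Bool, if sliceV V f false ω then
            F (rsig6 Z₁ u u' u'' a₁ (Function.update st f .absent) ω)
              (bsig6 Z₁ u u' u'' a₁ (Function.update st f .double) ω)
          else 0 := by
  unfold cntF6
  rw [two_mul_sum_eq_flip, ← Finset.sum_add_distrib]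
  exact Finset.sum_congr rfl fun ω _ => F6_summand_add_flip Z₁ u u' u'' a₁ F st f hf V ω

open Classical in
/-- The induction step for an anchored four-mark functional. -/
theorem cntF6_step {F : P6 → P6 → ℤ} (hi : IncrRed6 F) (hii : KeyIneq6 F) (st : E₁ → EStat) (f : E₁)
    (hf : st f = .free) (hT : Z₁.fst f ∈ dblCompS Z₁ st a₁ ∨ Z₁.snd f ∈ dblCompS Z₁ st a₁)
    {V : (E₁ → Bool) → Prop} (hV : UpSet V) :
    cntF6 Z₁ u u' u'' a₁ F (Function.update st f .absent) (sliceV V f true)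
        + cntF6 Z₁ u u' u'' a₁ F (Function.update st f .double) (sliceV V f false) ≤
      (∑ ω : E₁ → Bool, if sliceV V f true ω then
          F (rsig6 Z₁ u u' u'' a₁ (Function.update st f .double) ω)
            (bsig6 Z₁ u u' u'' a₁ (Function.update st f .absent) ω)
        else 0)
        + ∑ ω : E₁ → Bool, if sliceV V f false ω then
            F (rsig6 Z₁ u u' u'' a₁ (Function.update st f .absent) ω)
              (bsig6 Z₁ u u' u'' a₁ (Function.update st f .double) ω)
          else 0 := by
  unfold cntF6
  rw [← Finset.sum_add_distrib, ← Finset.sum_add_distrib]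
  refine Finset.sum_le_sum fun ω _ => ?_
  exact F6_ind_ineq hi hii _ _ (sliceV_false_le hV f ω) _ _ _ _ (trans6_rsig6 Z₁ u u' u'' a₁ _ ω)
    (trans6_rsig6 Z₁ u u' u'' a₁ _ ω) (trans6_bsig6 Z₁ u u' u'' a₁ _ ω) (trans6_bsig6 Z₁ u u' u'' a₁ _ ω)
    (xmerge6_rsig6 Z₁ u u' u'' a₁ hf hT ω) (xmerge6_bsig6 Z₁ u u' u'' a₁ hf hT ω)

open Classical in
/-- Without a free edge at the anchor's double-component the count of an anchored four-mark functional vanishes. -/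
theorem cntF6_eq_zero {F : P6 → P6 → ℤ} (ha : Anchored6 F) (st : E₁ → EStat)
    (hA : ∀ e, st e = .free → ¬ (Z₁.fst e ∈ dblCompS Z₁ st a₁ ∨ Z₁.snd e ∈ dblCompS Z₁ st a₁))
    (V : (E₁ → Bool) → Prop) : cntF6 Z₁ u u' u'' a₁ F st V = 0 := by
  unfold cntF6
  refine Finset.sum_eq_zero fun ω _ => ?_
  have h : F (rsig6 Z₁ u u' u'' a₁ st ω) (bsig6 Z₁ u u' u'' a₁ st ω) = 0 := by
    apply ha <;> simp only [rsig6, bsig6, decide_eq_decide] <;>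
      rw [RdS_iff_dblComp Z₁ a₁ st hA, MgS_iff_dblComp Z₁ a₁ st hA]
  rw [h]
  simp

open Classical in
/-- **THEOREM (THE ANCHORED CONE, FOUR MARKS)**: a four-mark functional anchored at `a₁` that is increasing in red
along x-merges and satisfies the key inequality has non-negative count on every up-set of every status. -/
theorem cntF6_nonneg_of_anchored {F : P6 → P6 → ℤ} (ha : Anchored6 F) (hi : IncrRed6 F) (hii : KeyIneq6 F)
    (st : E₁ → EStat) {V : (E₁ → Bool) → Prop} (hV : UpSet V) : 0 ≤ cntF6 Z₁ u u' u'' a₁ F st V := by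
  suffices h : ∀ n : ℕ, ∀ st : E₁ → EStat, nfree st = n → ∀ V : (E₁ → Bool) → Prop, UpSet V →
      0 ≤ cntF6 Z₁ u u' u'' a₁ F st V from h _ st rfl V hV
  intro n
  induction n with
  | zero =>
    intro st hst V _
    have hno : ∀ e, st e ≠ .free := by
      intro e he
      have : e ∈ (univ.filter fun e => st e = .free) := by simp [he]
      rw [Finset.card_eq_zero.mp hst] at this
      exact absurd this (Finset.notMem_empty e)
    rw [cntF6_eq_zero Z₁ u u' u'' a₁ ha st (fun e he _ => hno e he) V]
  | succ n ih =>
    intro st hst V hV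
    by_cases hex : ∃ f, st f = .free ∧ (Z₁.fst f ∈ dblCompS Z₁ st a₁ ∨ Z₁.snd f ∈ dblCompS Z₁ st a₁)
    · obtain ⟨f, hf, hT⟩ := hex
      have hab := ih (Function.update st f .absent) (by
        have := nfree_update hf (s := .absent) (by decide); omega) (sliceV V f true) (upSet_sliceV hV f true)
      have hdb := ih (Function.update st f .double) (by
        have := nfree_update hf (s := .double) (by decide); omega) (sliceV V f false) (upSet_sliceV hV f false)
      have hR := cntF6_rec Z₁ u u' u'' a₁ F st f hf V
      have hS := cntF6_step Z₁ u u' u'' a₁ hi hii st f hf hT hV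
      linarith
    · have hA : ∀ e, st e = .free → ¬ (Z₁.fst e ∈ dblCompS Z₁ st a₁ ∨ Z₁.snd e ∈ dblCompS Z₁ st a₁) :=
        fun e he h => hex ⟨e, he, h⟩
      rw [cntF6_eq_zero Z₁ u u' u'' a₁ ha st hA V]

end MultiExit

end ZoneZ

end PercRepro
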